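import Summits.KontsevichZagierPeriods.Zeta5Search.LaiSweepShard

/-!
# `κ₃` sweep certificate — shard file 051 of 127 (shards 357–363 of 889)

HONEST FRAMING. Systematic search; no irrationality claim unless certified. This file only checks,
by `decide +kernel`, shards 357–363 of the order-cell sweep of the `κ₃` point `(74, 2180, 444; δ74)`
(engine `LaiSweepEngine`, soundness `LaiSweepJump/Free/Eval/Shard/Kappa3`; a shard is `⟨regime, n,
p, q, p', q', Lo, Up⟩`: `n` cells from `p/q` to `p'/q'` with integer rate sums in `[Lo, Up]`, `K =
128`, `D = 2^40`). It draws NO conclusion: only the capstone `LaiKappa3SweepCert`, which needs all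
127 shard files, does. Kernel cost of this file ≈ 560 cells × 0.3 s.
-/

namespace Summit.KontsevichZagierPeriods.Zeta5Search.Sweep

set_option maxHeartbeats 100000000 in
/-- Shard 357: 80 cells of regime B from `46/139` to `90/271`.
[cite: Lai2024BallRivoal, §4 Lemma 4.3] -/
theorem shard357 :
    Shard.check 128 (2^40)
      ⟨true, 80, 46, 139, 90, 271, 19254746777140, 20975722530445⟩ = true := by
  decide +kernel

set_option maxHeartbeats 100000000 in
/-- Shard 358: 80 cells of regime B from `90/271` to `134/401`.
[cite: Lai2024BallRivoal, §4 Lemma 4.3] -/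
theorem shard358 :
    Shard.check 128 (2^40)
      ⟨true, 80, 90, 271, 134, 401, 33767483861890, 36829768486322⟩ = true := by
  decide +kernel

set_option maxHeartbeats 100000000 in
/-- Shard 359: 80 cells of regime B from `134/401` to `66/197`.
[cite: Lai2024BallRivoal, §4 Lemma 4.3] -/
theorem shard359 :
    Shard.check 128 (2^40)
      ⟨true, 80, 134, 401, 66, 197, 14090646796383, 15376088967906⟩ = true := by
  decide +kernel

set_option maxHeartbeats 100000000 in
/-- Shard 360: 80 cells of regime B from `66/197` to `118/351`.
[cite: Lai2024BallRivoal, §4 Lemma 4.3] -/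
theorem shard360 :
    Shard.check 128 (2^40)
      ⟨true, 80, 66, 197, 118, 351, 18914720809180, 20652087966458⟩ = true := by
  decide +kernel

set_option maxHeartbeats 100000000 in
/-- Shard 361: 80 cells of regime B from `118/351` to `55/163`.
[cite: Lai2024BallRivoal, §4 Lemma 4.3] -/
theorem shard361 :
    Shard.check 128 (2^40)
      ⟨true, 80, 118, 351, 55, 163, 20255983666233, 22131546906789⟩ = true := by
  decide +kernel

set_option maxHeartbeats 100000000 in
/-- Shard 362: 80 cells of regime B from `55/163` to `21/62`.
[cite: Lai2024BallRivoal, §4 Lemma 4.3] -/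
theorem shard362 :
    Shard.check 128 (2^40)
      ⟨true, 80, 55, 163, 21, 62, 20898539726270, 22849862780639⟩ = true := by
  decide +kernel

set_option maxHeartbeats 100000000 in
/-- Shard 363: 80 cells of regime B from `21/62` to `86/253`.
[cite: Lai2024BallRivoal, §4 Lemma 4.3] -/
theorem shard363 :
    Shard.check 128 (2^40)
      ⟨true, 80, 21, 62, 86, 253, 19663554853619, 21514713154814⟩ = true := by
  decide +kernel

/-- The checked shards of this file, in order. [folklore] -/
def shards051 : List (CheckedShard 128 (2^40)) :=
  [⟨_, shard357⟩, ⟨_, shard358⟩, ⟨_, shard359⟩, ⟨_, shard360⟩, ⟨_, shard361⟩,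
    ⟨_, shard362⟩, ⟨_, shard363⟩]

end Summit.KontsevichZagierPeriods.Zeta5Search.Sweep
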